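import Mathlib.Analysis.Complex.Basic
import Mathlib.Algebra.Module.LinearMap.Rat
import Literature.NumberTheory.Transcendental.ExpPointsExamples
import Literature.NumberTheory.Transcendental.ExpCurveZeros
import Literature.NumberTheory.Transcendental.ZariskiDimCoordRelations
import HarnessLib

/-!
# Exponential points of low-dimensional closed sets: symmetry, discreteness, pigeonholes

Elementary structure of the set `indepExpPoints W` (`ExpPointsExamples.lean`) of ℚ-linearly
independent `x ∈ ℂ²` with `(x, eˣ) ∈ W`, for `W ⊆ ℂ² × ℂ²`:

* `conj_apply_mem_of_isDefinedOver_bot`, `conj_comp_mem_indepExpPoints` — a set defined over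
  `ℚ = ⊥` is stable under coordinatewise complex conjugation, and so are its independent
  exponential points;
* `finite_indepExpPoints_norm_le`, `exists_unbounded_coord` — if `zariskiDim ℂ W < 2`, every
  coordinate `x_j` together with `e^{x_j}` satisfies a non-trivial polynomial relation on `W`
  (`ZariskiDimCoordRelations`), whose solutions are discrete (`ExpCurveZeros`); hence only
  finitely many independent exponential points lie in any bounded box, and an infinite set of
  them is unbounded in one of the two coordinates, in the strong sense
  `∀ R, {x | R < ‖x i‖}` infinite;
* `exists_infinite_class` — the pigeonhole principle preserving this unboundedness.

[folklore]
-/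

noncomputable section

open Complex MvPolynomial Filter Set

namespace Literature.NumberTheory.Transcendental

/-! ### Complex conjugation -/

/-- Elements of the prime subfield `⊥ ⊆ ℂ` are fixed by complex conjugation. [folklore] -/
theorem conj_eq_self_of_mem_bot {c : ℂ} (hc : c ∈ (⊥ : Subfield ℂ)) : (starRingEnd ℂ) c = c := by
  let S : Subfield ℂ :=
    { carrier := {x | (starRingEnd ℂ) x = x}
      mul_mem' := fun {a b} ha hb => by
        simp only [Set.mem_setOf_eq] at ha hb ⊢; rw [map_mul, ha, hb]
      one_mem' := by simp
      add_mem' := fun {a b} ha hb => by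
        simp only [Set.mem_setOf_eq] at ha hb ⊢; rw [map_add, ha, hb]
      zero_mem' := by simp
      neg_mem' := fun {a} ha => by
        simp only [Set.mem_setOf_eq] at ha ⊢; rw [map_neg, ha]
      inv_mem' := fun a ha => by
        simp only [Set.mem_setOf_eq] at ha ⊢; rw [map_inv₀, ha] }
  have : c ∈ S := (bot_le : (⊥ : Subfield ℂ) ≤ S) hc
  exact this

/-- Conjugating the point conjugates the value of a polynomial with coefficients in `⊥`.
[folklore] -/
theorem aeval_conj_comp {ι : Type*} (p : MvPolynomial ι (⊥ : Subfield ℂ)) (z : ι → ℂ) :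
    aeval (fun k => (starRingEnd ℂ) (z k)) p = (starRingEnd ℂ) (aeval z p) := by
  induction p using MvPolynomial.induction_on with
  | C c =>
    rw [aeval_C, aeval_C]
    exact (conj_eq_self_of_mem_bot (c.2)).symm
  | add p q hp hq => rw [map_add, map_add, hp, hq, map_add]
  | mul_X p k hp => rw [map_mul, map_mul, hp, aeval_X, aeval_X, map_mul]

/-- **Sets defined over `ℚ` are stable under complex conjugation.** [folklore] -/
theorem conj_apply_mem_of_isDefinedOver_bot {ι : Type*} {W : Set (ι → ℂ)}
    (hW : IsDefinedOver (⊥ : Subfield ℂ) W) {z : ι → ℂ} (hz : z ∈ W) :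
    (fun k => (starRingEnd ℂ) (z k)) ∈ W := by
  obtain ⟨I, rfl⟩ := hW
  rw [MvPolynomial.mem_zeroLocus_iff] at hz ⊢
  intro p hp
  rw [aeval_conj_comp, hz p hp, map_zero]

/-- Conjugation of a point `(x, eˣ)`. [folklore] -/
theorem conj_sumElim_exp (x : Fin 2 → ℂ) :
    (fun k => (starRingEnd ℂ) (Sum.elim x (Complex.exp ∘ x) k)) =
      Sum.elim (fun j => (starRingEnd ℂ) (x j)) (Complex.exp ∘ fun j => (starRingEnd ℂ) (x j)) := by
  funext k
  rcases k with j | j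
  · rfl
  · simp only [Sum.elim_inr, Function.comp_apply, Complex.exp_conj]

/-- ℚ-linear independence is preserved by complex conjugation. [folklore] -/
theorem linearIndependent_conj_comp {x : Fin 2 → ℂ} (hx : LinearIndependent ℚ x) :
    LinearIndependent ℚ fun j => (starRingEnd ℂ) (x j) := by
  let f : ℂ →ₗ[ℚ] ℂ := ((starRingEnd ℂ : ℂ →+* ℂ) : ℂ →+ ℂ).toRatLinearMap
  have hfapp : ∀ z, f z = (starRingEnd ℂ) z := fun z => rfl
  have hf : LinearMap.ker f = ⊥ := by
    rw [LinearMap.ker_eq_bot]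
    intro a b hab
    rw [hfapp, hfapp] at hab
    exact (starRingEnd ℂ).injective hab
  have h := hx.map' f hf
  have hfun : (⇑f ∘ x) = fun j => (starRingEnd ℂ) (x j) := funext fun j => hfapp (x j)
  rwa [hfun] at h

/-- **Independent exponential points of a `ℚ`-set are stable under conjugation.** [folklore] -/
theorem conj_comp_mem_indepExpPoints {W : Set (Fin 2 ⊕ Fin 2 → ℂ)}
    (hW : IsDefinedOver (⊥ : Subfield ℂ) W) {x : Fin 2 → ℂ} (hx : x ∈ indepExpPoints W) :
    (fun j => (starRingEnd ℂ) (x j)) ∈ indepExpPoints W := by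
  refine ⟨linearIndependent_conj_comp hx.1, ?_⟩
  rw [← conj_sumElim_exp]
  exact conj_apply_mem_of_isDefinedOver_bot hW hx.2

/-! ### Discreteness: finitely many independent exponential points in a bounded box -/

/-- **Finitely many independent exponential points in a box**, for `zariskiDim ℂ W < 2`: the
coordinate `x_j` and `e^{x_j}` satisfy a non-trivial polynomial relation on `W`, with finitely
many solutions in every disc. [folklore] -/
theorem finite_indepExpPoints_norm_le {W : Set (Fin 2 ⊕ Fin 2 → ℂ)} (hdim : zariskiDim ℂ W < 2)
    (R : ℝ) : Set.Finite {x : Fin 2 → ℂ | x ∈ indepExpPoints W ∧ ‖x 0‖ ≤ R ∧ ‖x 1‖ ≤ R} := by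
  obtain ⟨P₀, hP₀, h₀⟩ := exists_relation_pair_of_zariskiDim_lt_two W hdim (Sum.inl 0) (Sum.inr 0)
  obtain ⟨P₁, hP₁, h₁⟩ := exists_relation_pair_of_zariskiDim_lt_two W hdim (Sum.inl 1) (Sum.inr 1)
  have hZ₀ : Set.Finite {u : ℂ | ‖u‖ ≤ R ∧ MvPolynomial.eval ![u, Complex.exp u] P₀ = 0} :=
    finite_zeros_eval_exp_norm_le hP₀ R
  have hZ₁ : Set.Finite {u : ℂ | ‖u‖ ≤ R ∧ MvPolynomial.eval ![u, Complex.exp u] P₁ = 0} :=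
    finite_zeros_eval_exp_norm_le hP₁ R
  have hprod := hZ₀.prod hZ₁
  refine Set.Finite.of_finite_image (f := fun x : Fin 2 → ℂ => (x 0, x 1)) (hprod.subset ?_) ?_
  · rintro _ ⟨x, ⟨hx, hx0, hx1⟩, rfl⟩
    have hW := hx.2
    have e0 : MvPolynomial.eval ![x 0, Complex.exp (x 0)] P₀ = 0 :=
      h₀ (Sum.elim x (Complex.exp ∘ x)) hW
    have e1 : MvPolynomial.eval ![x 1, Complex.exp (x 1)] P₁ = 0 :=
      h₁ (Sum.elim x (Complex.exp ∘ x)) hW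
    exact Set.mk_mem_prod ⟨hx0, e0⟩ ⟨hx1, e1⟩
  · intro x _ y _ hxy
    simp only [Prod.mk.injEq] at hxy
    funext j; fin_cases j
    · exact hxy.1
    · exact hxy.2

/-- **An infinite set of independent exponential points is unbounded in one coordinate**, in the
strong sense that `{x | R < ‖x i‖}` is infinite for every `R`. [folklore] -/
theorem exists_unbounded_coord {W : Set (Fin 2 ⊕ Fin 2 → ℂ)} (hdim : zariskiDim ℂ W < 2)
    (hinf : (indepExpPoints W).Infinite) :
    ∃ i : Fin 2, ∀ R : ℝ, Set.Infinite {x : Fin 2 → ℂ | x ∈ indepExpPoints W ∧ R < ‖x i‖} := by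
  by_contra hcon
  push Not at hcon
  obtain ⟨R₀, hR₀⟩ := hcon 0
  obtain ⟨R₁, hR₁⟩ := hcon 1
  apply hinf
  refine ((hR₀.union hR₁).union (finite_indepExpPoints_norm_le hdim (max R₀ R₁))).subset ?_
  intro x hx
  rcases lt_or_ge R₀ ‖x 0‖ with h0 | h0
  · exact Or.inl (Or.inl ⟨hx, h0⟩)
  rcases lt_or_ge R₁ ‖x 1‖ with h1 | h1
  · exact Or.inl (Or.inr ⟨hx, h1⟩)
  · exact Or.inr ⟨hx, h0.trans (le_max_left _ _), h1.trans (le_max_right _ _)⟩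

/-! ### The pigeonhole principle preserving unboundedness -/

/-- **Pigeonhole preserving unboundedness.** If `{a ∈ T | R < ν a}` is infinite for every `R`
and `T` is covered by finitely many classes `U i`, then one class `U i` has the same property.
[folklore] -/
theorem exists_infinite_class {α ι : Type*} {T : Set α} {ν : α → ℝ}
    (hT : ∀ R : ℝ, Set.Infinite {a | a ∈ T ∧ R < ν a}) (s : Finset ι) (U : ι → Set α)
    (hcov : ∀ a ∈ T, ∃ i ∈ s, a ∈ U i) :
    ∃ i ∈ s, ∀ R : ℝ, Set.Infinite {a | a ∈ T ∧ a ∈ U i ∧ R < ν a} := by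
  classical
  by_contra hcon
  push Not at hcon
  choose! Rb hRb using hcon
  have hne : s.Nonempty := by
    obtain ⟨a, ha⟩ := (hT 0).nonempty
    obtain ⟨i, hi, -⟩ := hcov a ha.1
    exact ⟨i, hi⟩
  -- a common bound
  set R : ℝ := s.sup' hne Rb with hR
  have hfin : Set.Finite (⋃ i ∈ s, {a | a ∈ T ∧ a ∈ U i ∧ Rb i < ν a}) :=
    Set.Finite.biUnion s.finite_toSet fun i hi => hRb i hi
  apply hT R
  refine hfin.subset ?_
  rintro a ⟨haT, hRa⟩
  obtain ⟨i, hi, hai⟩ := hcov a haT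
  refine Set.mem_biUnion hi ⟨haT, hai, lt_of_le_of_lt ?_ hRa⟩
  rw [hR]; exact Finset.le_sup' Rb hi

end Literature.NumberTheory.Transcendental

end
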